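import Literature.NumberTheory.Transcendental.QuadraticRelationsLogarithmsSec4Subspaces
import HarnessLib

/-!
# Roy–Waldschmidt 1997, §4: Lemme 4.6 (coordinate projections) and Lemme 4.7 (lifting a subspace of `κⁿ`)

D. Roy, M. Waldschmidt, *Approximation diophantienne et indépendance algébrique de logarithmes*,
Ann. Sci. ÉNS (4) 30 (1997) 753–796, §4, p. 775.

> **Lemme 4.6.** Soit `k` un entier positif `≤ n`, soit `π : ℂⁿ → ℂᵏ` l'application linéaire de
> projection sur les `k` premières coordonnées donnée par `π(a₁, …, aₙ) = (a₁, …, a_k)`, et soit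
> `V` un sous-espace de `Kⁿ`. On pose `V₁ = π(V)`. Alors, on a `h(V₁) ≤ h(V)`. De plus, si
> `h(V) < D`, alors `V̄₁ = π(V̄)`.

We state it for the projection `v ↦ v ∘ ι` onto the coordinates selected by an arbitrary injection
`ι : m ↪ n` (`LinearMap.funLeft K K ι`; the paper's case is `ι = Fin.castLE`), and prove:

* `lemme_4_6_height` — `h(π(V)) ≤ h(V)`.  The printed proof deduces this from Lemme 4.5 through the
  identity `ord_q(e_{k+1} ∧ ⋯ ∧ e_n ∧ x₁ ∧ ⋯ ∧ x_r) = ord_q(π(x₁) ∧ ⋯ ∧ π(x_r))`; we use the same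
  adapted basis `(z, x)` of `V` (`z` a basis of `V ∩ ker π`, `π(x)` a basis of `π(V)`) and read the
  inequality directly off the Plücker coordinates: among the maximal minors of `(z, x)` are all the
  products `(minor of z on the complementary coordinates) · (minor of π(x))` (block-triangular
  minors), so `h(π(V)) ≤ h(z|_{Jᶜ}) + h(π(V)) = h(sub-tuple) ≤ h(V)` (`projHeight_kronecker`,
  `projHeight_comp_le`).
* `lemme_4_6_reduction` — if `h(V) < D = deg 𝔭` then `π(V)‾ = π̄(V̄)`, following the printed proof:
  `V₀ = ker π` is defined over `ℚ` (`h(V₀) = 0`), Lemme 4.5 gives `(V₀ ∩ V)‾ = V̄₀ ∩ V̄` with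
  `V̄₀ = ker π̄` (`reduction_ker_funLeft`), and a dimension count with `dim_κ V̄ = dim_K V`
  (`finrank_reduction`) turns the inclusion `π̄(V̄) ⊆ π(V)‾` into an equality.

> **Lemme 4.7.** Soient `V₁, V₂` des sous-espaces de `Kⁿ` et `S` un sous-espace de `κⁿ`. On
> suppose que `U = V₁ ∩ V₂` vérifie `Ū = V̄₁ ∩ V̄₂`. Alors, il existe un sous-espace `R` de `Kⁿ` avec
> `R̄ = S` qui remplit les conditions `dim_K(Vᵢ ∩ R) ≥ dim_κ(V̄ᵢ ∩ S)` pour `i = 1, 2`.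

* `lemme_4_7` — as printed, following the printed proof: a basis `C̄` of `Ū ∩ S` lifted to
  `C ⊂ U ∩ 𝒪ⁿ`, completed to bases `C̄ ∪ B̄ᵢ` of `V̄ᵢ ∩ S` lifted to `Bᵢ ⊂ Vᵢ ∩ 𝒪ⁿ` (the family
  `C̄ ∪ B̄₁ ∪ B̄₂` is free because `Ū ∩ S = (V̄₁ ∩ S) ∩ (V̄₂ ∩ S)`), completed to a basis of `S` by
  `B̄` lifted to `B ⊂ 𝒪ⁿ`; `R` is the `K`-span of `C ∪ B₁ ∪ B₂ ∪ B`, `S ⊆ R̄` and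
  `dim R̄ = dim R ≤ dim S` give `R̄ = S`, and `C ∪ Bᵢ ⊂ Vᵢ ∩ R` is `K`-free because its reduction is
  `κ`-free (`linearIndependent_inclVec_of_redVec`).

Everything is proved; no named facts are introduced.

## References

* [RoyWaldschmidt1997ENS] D. Roy, M. Waldschmidt, Ann. Sci. ÉNS (4) 30 (1997) 753–796, §4,
  Lemme 4.6, p. 775; Lemme 4.7, pp. 775–776.
-/

noncomputable section

open scoped Classical

namespace Literature.NumberTheory.Transcendental

namespace RoyWaldschmidt1997

open Literature.NumberTheory.DiophantineGeometry
open Literature.NumberTheory.DiophantineGeometry.AlgFunctionField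

universe u v

variable {k : Type u} {K : Type v} [Field k] [Field K] [Algebra k K]

open Module Submodule

variable {n : Type*} [Fintype n]

/-! ### Sub-tuples and products of projective points -/

section SubTuple

variable {ι ι' : Type*} [Fintype ι] [Fintype ι']

omit [Fintype n] in
/-- A sub-tuple (or any reindexing along a map) has larger `ord_q`. [folklore] -/
theorem ordVec_le_ordVec_comp (q : PlaceOver k K) (v : ι → K) (φ : ι' → ι) (h : v ∘ φ ≠ 0) :
    ordVec q v ≤ ordVec q (v ∘ φ) := by
  rw [le_ordVec_iff q h]
  intro i hi
  exact ordVec_le q (x := v) (i := φ i) hi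

omit [Fintype n] in
/-- **The height of a sub-tuple is at most the height of the tuple**: `h(v ∘ φ) ≤ h(v)` for any
map `φ` of index sets. [folklore] -/
theorem projHeight_comp_le [IsAlgFunctionField k K] (v : ι → K) (φ : ι' → ι) :
    projHeight k (v ∘ φ) ≤ projHeight k v := by
  by_cases h : v ∘ φ = 0
  · rw [h, projHeight_zero]; exact projHeight_nonneg _
  obtain ⟨T, hT, -⟩ := exists_finset_places (k := k) {v} ∅
  obtain ⟨T', hT', -⟩ := exists_finset_places (k := k) {v ∘ φ} ∅
  rw [projHeight_eq_sum v (T ∪ T') fun q hq ↦ Finset.mem_union_left _ (hT v (by simp) q hq),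
    projHeight_eq_sum (v ∘ φ) (T ∪ T') fun q hq ↦ Finset.mem_union_right _ (hT' _ (by simp) q hq)]
  exact Finset.sum_le_sum fun q _ ↦ neg_le_neg
    (mul_le_mul_of_nonneg_right (ordVec_le_ordVec_comp q v φ h) (Nat.cast_nonneg _))

variable {α β : Type*} [Fintype α] [Fintype β]

omit [Fintype n] in
/-- `ord_q` of a product tuple `(ζ_a ξ_b)_{a,b}` is `ord_q(ζ) + ord_q(ξ)`. [folklore] -/
theorem ordVec_kronecker (q : PlaceOver k K) {ζ : α → K} {ξ : β → K} (hζ : ζ ≠ 0) (hξ : ξ ≠ 0) :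
    ordVec q (fun ab : α × β ↦ ζ ab.1 * ξ ab.2) = ordVec q ζ + ordVec q ξ := by
  have hne : (fun ab : α × β ↦ ζ ab.1 * ξ ab.2) ≠ 0 := by
    obtain ⟨a, ha⟩ := Function.ne_iff.1 hζ
    obtain ⟨b, hb⟩ := Function.ne_iff.1 hξ
    exact fun h0 ↦ mul_ne_zero ha hb (congr_fun h0 (a, b))
  refine le_antisymm ?_ ?_
  · obtain ⟨a, ha, hqa⟩ := exists_ordVec_eq q hζ
    obtain ⟨b, hb, hqb⟩ := exists_ordVec_eq q hξ
    have := ordVec_le q (x := fun ab : α × β ↦ ζ ab.1 * ξ ab.2) (i := (a, b)) (mul_ne_zero ha hb)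
    rw [q.ord_mul_eq ha hb] at this
    rw [hqa, hqb]; exact this
  · rw [le_ordVec_iff q hne]
    rintro ⟨a, b⟩ hab
    have ha : ζ a ≠ 0 := left_ne_zero_of_mul hab
    have hb : ξ b ≠ 0 := right_ne_zero_of_mul hab
    show ordVec q ζ + ordVec q ξ ≤ q.ord (ζ a * ξ b)
    rw [q.ord_mul_eq ha hb]
    exact add_le_add (ordVec_le q ha) (ordVec_le q hb)

omit [Fintype n] in
/-- **Heights of product tuples add**: `h((ζ_a ξ_b)_{a,b}) = h(ζ) + h(ξ)` for nonzero tuples.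
[folklore] -/
theorem projHeight_kronecker [IsAlgFunctionField k K] {ζ : α → K} {ξ : β → K} (hζ : ζ ≠ 0)
    (hξ : ξ ≠ 0) :
    projHeight k (fun ab : α × β ↦ ζ ab.1 * ξ ab.2) = projHeight k ζ + projHeight k ξ := by
  obtain ⟨T, hT, -⟩ := exists_finset_places (k := k) {ζ} ∅
  obtain ⟨T', hT', -⟩ := exists_finset_places (k := k) {ξ} ∅
  have hζT : ∀ q, ordVec q ζ ≠ 0 → q ∈ T ∪ T' := fun q hq ↦
    Finset.mem_union_left _ (hT ζ (by simp) q hq)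
  have hξT : ∀ q, ordVec q ξ ≠ 0 → q ∈ T ∪ T' := fun q hq ↦
    Finset.mem_union_right _ (hT' ξ (by simp) q hq)
  have hpT : ∀ q, ordVec q (fun ab : α × β ↦ ζ ab.1 * ξ ab.2) ≠ 0 → q ∈ T ∪ T' := by
    intro q hq
    rw [ordVec_kronecker q hζ hξ] at hq
    by_cases h1 : ordVec q ζ = 0
    · rw [h1, zero_add] at hq; exact hξT q hq
    · exact hζT q h1
  rw [projHeight_eq_sum _ _ hpT, projHeight_eq_sum _ _ hζT, projHeight_eq_sum _ _ hξT,
    ← Finset.sum_add_distrib]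
  refine Finset.sum_congr rfl fun q _ ↦ ?_
  rw [ordVec_kronecker q hζ hξ]; ring

end SubTuple

/-! ### Coordinate projections -/

section Projection

variable {m : Type*} [Fintype m]

omit [Fintype n] [Fintype m] in
/-- The projection `v ↦ v ∘ ι` commutes with every map of the coordinate ring; in particular with
reduction and with the inclusion `𝒪 ⊆ K`. [folklore] -/
theorem funLeft_apply' {F : Type*} [Semiring F] (ι : m ↪ n) (v : n → F) :
    LinearMap.funLeft F F ι v = v ∘ ι := rfl

/-- **The kernel of a coordinate projection is spanned by the complementary standard vectors**
(the space `V₀` of the proof of Lemme 4.6, "défini sur `ℚ`"). [cite: RoyWaldschmidt1997ENS, Lemme 4.6 (proof), p. 775] -/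
theorem ker_funLeft_eq_span {F : Type*} [Field F] [DecidableEq n] (ι : m ↪ n) :
    LinearMap.ker (LinearMap.funLeft F F ι) =
      span F ((fun j ↦ (Pi.single j 1 : n → F)) '' (Set.range ι)ᶜ) := by
  refine le_antisymm (fun v hv ↦ ?_) (span_le.2 ?_)
  · rw [LinearMap.mem_ker, funLeft_apply'] at hv
    rw [← Finset.univ_sum_single v]
    refine sum_mem fun j _ ↦ ?_
    by_cases hj : j ∈ Set.range ι
    · obtain ⟨i, rfl⟩ := hj
      have : v (ι i) = 0 := congr_fun hv i
      rw [this, Pi.single_zero]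
      exact zero_mem _
    · have : (Pi.single j (v j) : n → F) = v j • (Pi.single j 1 : n → F) := by
        ext j'
        by_cases h : j' = j
        · subst h; simp
        · simp [Pi.single_eq_of_ne h]
      rw [this]
      exact smul_mem _ _ (subset_span ⟨j, hj, rfl⟩)
  · rintro _ ⟨j, hj, rfl⟩
    rw [SetLike.mem_coe, LinearMap.mem_ker, funLeft_apply']
    funext i
    have : (ι i : n) ≠ j := fun h ↦ hj ⟨i, h⟩
    simp [Pi.single_eq_of_ne this]

variable (p : PlaceOver k K)

omit [Fintype n] [Fintype m] in
/-- **`ker π` reduces to `ker π̄`** (`V₀` is defined over `ℚ`). [cite: RoyWaldschmidt1997ENS, Lemme 4.6 (proof), p. 775] -/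
theorem reduction_ker_funLeft (ι : m ↪ n) :
    reduction p (LinearMap.ker (LinearMap.funLeft K K ι)) =
      LinearMap.ker (LinearMap.funLeft p.residueField p.residueField ι) := by
  ext y
  rw [mem_reduction_iff, LinearMap.mem_ker, funLeft_apply']
  constructor
  · rintro ⟨x, hx, rfl⟩
    rw [mem_integralPoints, LinearMap.mem_ker, funLeft_apply'] at hx
    funext i
    have h1 : (x (ι i) : K) = 0 := congr_fun hx i
    have h2 : x (ι i) = 0 := Subtype.ext h1
    simp [h2]
  · intro hy
    choose x₀ hx₀ using fun j ↦ IsLocalRing.residue_surjective (R := p.toValuationSubring) (y j)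
    refine ⟨fun j ↦ if j ∈ Set.range ι then 0 else x₀ j, ?_, ?_⟩
    · rw [mem_integralPoints, LinearMap.mem_ker, funLeft_apply']
      funext i
      simp [inclVec]
    · funext j
      by_cases hj : j ∈ Set.range ι
      · obtain ⟨i, rfl⟩ := hj
        have : y (ι i) = 0 := congr_fun hy i
        simp [redVec, this]
      · simp [redVec, hj, hx₀ j]

omit [Fintype n] [Fintype m] in
/-- `π̄(V̄) ⊆ π(V)‾` (reduction of the projection of an integral point is the projection of its
reduction). [cite: RoyWaldschmidt1997ENS, Lemme 4.6 (proof), p. 775] -/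
theorem map_funLeft_reduction_le (ι : m ↪ n) (V : Submodule K (n → K)) :
    (reduction p V).map (LinearMap.funLeft p.residueField p.residueField ι) ≤
      reduction p (V.map (LinearMap.funLeft K K ι)) := by
  rintro _ ⟨y, hy, rfl⟩
  obtain ⟨x, hx, rfl⟩ := (mem_reduction_iff p).1 hy
  rw [funLeft_apply']
  refine (mem_reduction_iff p).2 ⟨x ∘ ι, ?_, rfl⟩
  rw [mem_integralPoints]
  exact ⟨inclVec p x, (mem_integralPoints p).1 hx, rfl⟩

omit [Fintype n] [Fintype m] in
/-- Rank–nullity for the restriction of a linear map to a finite-dimensional subspace: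
`dim f(V) + dim (V ∩ ker f) = dim V`. [folklore] -/
theorem finrank_map_add_finrank_inf_ker_of_field {F M M₂ : Type*} [Field F] [AddCommGroup M] [Module F M]
    [AddCommGroup M₂] [Module F M₂] (f : M →ₗ[F] M₂) (V : Submodule F M) [FiniteDimensional F V] :
    finrank F ↥(V.map f) + finrank F ↥(V ⊓ LinearMap.ker f) = finrank F V := by
  have h := LinearMap.finrank_range_add_finrank_ker (f.domRestrict V)
  rw [LinearMap.range_domRestrict] at h
  have hker : LinearMap.ker (f.domRestrict V) = (V ⊓ LinearMap.ker f).comap V.subtype := by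
    ext ⟨v, hv⟩
    simp
  rw [hker] at h
  have hle : V ⊓ LinearMap.ker f ≤ V := inf_le_left
  rw [(Submodule.comapSubtypeEquivOfLe hle).finrank_eq] at h
  exact h

variable [DecidableEq n]

/-- **Roy–Waldschmidt, Lemme 4.6 (first part): `h(π(V)) ≤ h(V)`** for the projection
`π : v ↦ v ∘ ι` onto a set of coordinates. [cite: RoyWaldschmidt1997ENS, Lemme 4.6, p. 775] -/
theorem lemme_4_6_height [IsAlgFunctionField k K] (ι : m ↪ n) (V : Submodule K (n → K)) :
    subspaceHeight k (V.map (LinearMap.funLeft K K ι)) ≤ subspaceHeight k V := by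
  set π := LinearMap.funLeft K K ι with hπ
  -- an adapted basis `(z, x)` of `V`: `z` a basis of `V ∩ ker π`
  obtain ⟨zli, zspan⟩ := finBasis_family (V ⊓ LinearMap.ker π)
  set s := finrank K ↥(V ⊓ LinearMap.ker π) with hs
  set z : Fin s → n → K :=
    fun l ↦ ((Module.finBasis K ↥(V ⊓ LinearMap.ker π) l : ↥(V ⊓ LinearMap.ker π)) : n → K) with hz
  have hzmem : ∀ l, z l ∈ V ⊓ LinearMap.ker π := fun l ↦
    (Module.finBasis K ↥(V ⊓ LinearMap.ker π) l).2
  have hzι : ∀ l i, z l (ι i) = 0 := fun l i ↦ by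
    have := (Submodule.mem_inf.1 (hzmem l)).2
    rw [LinearMap.mem_ker, funLeft_apply'] at this
    exact congr_fun this i
  obtain ⟨r, x, hxV, hli, hspan⟩ :=
    exists_linearIndependent_extension V (v := z) (fun l ↦ (hzmem l).1) zli
  have hV : subspaceHeight k V = projHeight k (minors (Sum.elim z x)) := subspaceHeight_eq hli hspan
  -- `π x` is a basis of `π(V)`
  set πx : Fin r → m → K := fun i ↦ x i ∘ ι with hπx
  have hπx_span : span K (Set.range πx) = V.map π := by
    rw [← hspan, Submodule.map_span, ← Set.range_comp, Sum.comp_elim, Set.Sum.elim_range,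
      span_union]
    have h0 : span K (Set.range (π ∘ z)) = ⊥ := by
      rw [Submodule.span_eq_bot]
      rintro _ ⟨l, rfl⟩
      funext i
      exact hzι l i
    rw [h0, bot_sup_eq]
    rfl
  have hπx_li : LinearIndependent K πx := by
    rw [Fintype.linearIndependent_iff]
    intro c hc
    set w := ∑ i, c i • x i with hw
    have hwV : w ∈ V := sum_mem fun i _ ↦ smul_mem _ _ (hxV i)
    have hwker : w ∈ LinearMap.ker π := by
      rw [LinearMap.mem_ker, map_sum]
      simp only [map_smul]
      exact hc
    have hwz : w ∈ span K (Set.range z) := by rw [zspan]; exact ⟨hwV, hwker⟩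
    have hwx : w ∈ span K (Set.range x) :=
      sum_mem fun i _ ↦ smul_mem _ _ (subset_span ⟨i, rfl⟩)
    obtain ⟨-, hxli, hd⟩ := linearIndependent_sum.1 hli
    simp only [Sum.elim_comp_inl, Sum.elim_comp_inr] at hxli hd
    have hw0 : w = 0 := by
      have := hd.le_bot (Submodule.mem_inf.2 ⟨hwz, hwx⟩)
      simpa using this
    exact Fintype.linearIndependent_iff.1 hxli c (by rw [← hw]; exact hw0)
  have hV₁ : subspaceHeight k (V.map π) = projHeight k (minors πx) := subspaceHeight_eq hπx_li hπx_span
  -- `z` restricted to the complementary coordinates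
  set Jc := {j : n // j ∉ Set.range ι} with hJc
  set zJ : Fin s → Jc → K := fun l j ↦ z l j with hzJ
  have hzJ_li : LinearIndependent K zJ := by
    rw [Fintype.linearIndependent_iff]
    intro c hc
    refine Fintype.linearIndependent_iff.1 zli c ?_
    funext j
    by_cases hj : j ∈ Set.range ι
    · obtain ⟨i, rfl⟩ := hj
      simp [Finset.sum_apply, hzι]
    · have := congr_fun hc ⟨j, hj⟩
      simpa [Finset.sum_apply, hzJ] using this
  have hzJ_ne : minors zJ ≠ 0 := by
    obtain ⟨f, hf⟩ := exists_minors_ne_zero hzJ_li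
    exact fun h0 ↦ hf (congr_fun h0 f)
  have hπx_ne : minors πx ≠ 0 := by
    obtain ⟨f, hf⟩ := exists_minors_ne_zero hπx_li
    exact fun h0 ↦ hf (congr_fun h0 f)
  -- the product sub-tuple of the Plücker coordinates of `(z, x)`
  set Φ : (Fin s → Jc) × (Fin r → m) → (Fin s ⊕ Fin r → n) :=
    fun ag ↦ Sum.elim (fun l ↦ (ag.1 l : n)) (fun i ↦ ι (ag.2 i)) with hΦ
  have hprod : minors (Sum.elim z x) ∘ Φ = fun ag ↦ minors zJ ag.1 * minors πx ag.2 := by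
    funext ag
    obtain ⟨a, g⟩ := ag
    simp only [Function.comp_apply]
    rw [minors_apply, minors_apply, minors_apply, ← Matrix.det_fromBlocks_zero₁₂]
    congr 1
    ext (i | i) (j | j)
    · rfl
    · simp [Matrix.fromBlocks, hΦ, hzι]
    · rfl
    · rfl
  calc subspaceHeight k (V.map π) = projHeight k (minors πx) := hV₁
    _ ≤ projHeight k (minors zJ) + projHeight k (minors πx) :=
        le_add_of_nonneg_left (projHeight_nonneg _)
    _ = projHeight k (fun ag : (Fin s → Jc) × (Fin r → m) ↦ minors zJ ag.1 * minors πx ag.2) :=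
        (projHeight_kronecker hzJ_ne hπx_ne).symm
    _ = projHeight k (minors (Sum.elim z x) ∘ Φ) := by rw [hprod]
    _ ≤ projHeight k (minors (Sum.elim z x)) := projHeight_comp_le _ _
    _ = subspaceHeight k V := hV.symm

/-- **Roy–Waldschmidt, Lemme 4.6 (second part): if `h(V) < D` then `π(V)‾ = π̄(V̄)`.**
[cite: RoyWaldschmidt1997ENS, Lemme 4.6, p. 775] -/
theorem lemme_4_6_reduction [IsAlgFunctionField k K] (ι : m ↪ n) (V : Submodule K (n → K))
    (hV : subspaceHeight k V < p.degree) :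
    reduction p (V.map (LinearMap.funLeft K K ι)) =
      (reduction p V).map (LinearMap.funLeft p.residueField p.residueField ι) := by
  have hV₀ : subspaceHeight k (LinearMap.ker (LinearMap.funLeft K K ι)) = 0 := by
    rw [ker_funLeft_eq_span]; exact subspaceHeight_span_single _
  have h45 := (lemme_4_5_reduction p (LinearMap.ker (LinearMap.funLeft K K ι)) V
    (by rw [hV₀, zero_add]; exact hV)).2
  rw [reduction_ker_funLeft] at h45
  -- dimension count
  have e1 := finrank_map_add_finrank_inf_ker_of_field (LinearMap.funLeft K K ι) V
  have e2 := finrank_map_add_finrank_inf_ker_of_field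
    (LinearMap.funLeft p.residueField p.residueField ι) (reduction p V)
  have e3 : finrank p.residueField
      ↥(reduction p V ⊓ LinearMap.ker (LinearMap.funLeft p.residueField p.residueField ι)) =
      finrank K ↥(V ⊓ LinearMap.ker (LinearMap.funLeft K K ι)) := by
    rw [inf_comm, ← h45, finrank_reduction, inf_comm]
  have e4 := finrank_reduction p V
  have e5 := finrank_reduction p (V.map (LinearMap.funLeft K K ι))
  refine (Submodule.eq_of_le_of_finrank_eq (map_funLeft_reduction_le p ι V) ?_).symm
  omega

end Projection

/-! ### Lemme 4.7 -/

section Lifting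

variable (p : PlaceOver k K)

omit [Fintype n] in
/-- **Integral vectors with `κ`-free reductions are `K`-free** (reduce a `K`-relation normalised
so that some coefficient is a unit of `𝒪`). [cite: RoyWaldschmidt1997ENS, Lemme 4.7 (proof), p. 776] -/
theorem linearIndependent_inclVec_of_redVec {r : Type*} [Fintype r]
    {x : r → n → p.toValuationSubring}
    (h : LinearIndependent p.residueField fun i ↦ redVec p (x i)) :
    LinearIndependent K fun i ↦ inclVec p (x i) := by
  rw [Fintype.linearIndependent_iff]
  intro a ha
  by_contra hne
  have ha0 : a ≠ 0 := fun h0 ↦ hne (fun i ↦ congr_fun h0 i)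
  -- normalise the relation
  set t := ordVec p a with ht
  set c : K := (p.uniformizer : K) ^ (-t) with hc
  have hc0 : c ≠ 0 := zpow_ne_zero _ p.coe_uniformizer_ne_zero
  have hcord : p.ord c = -t := p.ord_uniformizer_zpow _
  have hmem : ∀ i, c * a i ∈ p.toValuationSubring := by
    intro i
    by_cases hi : a i = 0
    · rw [hi, mul_zero]; exact zero_mem _
    rw [p.mem_toValuationSubring_iff_ord_nonneg (mul_ne_zero hc0 hi), p.ord_mul_eq hc0 hi, hcord]
    have := ordVec_le p hi
    omega
  obtain ⟨i₀, hi₀, hi₀t⟩ := exists_ordVec_eq p ha0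
  have hunit : IsUnit (⟨c * a i₀, hmem i₀⟩ : p.toValuationSubring) := by
    refine isUnit_of_ord_eq_zero p _ (mul_ne_zero hc0 hi₀) ?_
    show p.ord (c * a i₀) = 0
    rw [p.ord_mul_eq hc0 hi₀, hcord, ← hi₀t]; ring
  -- the integral relation and its reduction
  set b : r → p.toValuationSubring := fun i ↦ ⟨c * a i, hmem i⟩ with hb
  have hsum : ∑ i, b i • x i = 0 := by
    rw [← inclVec_eq_zero_iff p, inclVec_sum]
    simp only [inclVec_smul, hb, mul_smul, ← Finset.smul_sum, ha, smul_zero]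
  have hred : ∑ i, IsLocalRing.residue p.toValuationSubring (b i) • redVec p (x i) = 0 := by
    have := congrArg (redVec p) hsum
    rw [redVec_sum, redVec_zero] at this
    simpa only [redVec_smul] using this
  have h0 := Fintype.linearIndependent_iff.1 h _ hred i₀
  exact ((isUnit_iff_residue_ne_zero p _).1 hunit) h0

omit [Fintype n] in
/-- A finite-dimensional subspace has a basis indexed by `Fin`, read in the ambient module.
[folklore] -/
theorem exists_basis_fin {F M : Type*} [Field F] [AddCommGroup M] [Module F M]
    [FiniteDimensional F M] (W : Submodule F M) :
    ∃ (a : ℕ) (c : Fin a → M), (∀ i, c i ∈ W) ∧ LinearIndependent F c ∧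
      span F (Set.range c) = W := by
  obtain ⟨a, c, hc, hli, hspan⟩ := exists_linearIndependent_extension W
    (v := fun i : Fin 0 ↦ (i.elim0 : M)) (fun i ↦ i.elim0) linearIndependent_empty_type
  refine ⟨a, c, hc, hli.comp Sum.inr Sum.inr_injective, ?_⟩
  rw [← hspan, Set.Sum.elim_range]
  congr 1
  ext v
  simp

/-- **Roy–Waldschmidt, Lemme 4.7.** Let `V₁, V₂ ⊆ Kⁿ` with `(V₁ ∩ V₂)‾ = V̄₁ ∩ V̄₂`, and let
`S ⊆ κⁿ` be a subspace. Then there is a subspace `R ⊆ Kⁿ` with `R̄ = S` and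
`dim_K(Vᵢ ∩ R) ≥ dim_κ(V̄ᵢ ∩ S)` for `i = 1, 2`. [cite: RoyWaldschmidt1997ENS, Lemme 4.7, pp. 775–776] -/
theorem lemme_4_7 (V₁ V₂ : Submodule K (n → K))
    (S : Submodule p.residueField (n → p.residueField))
    (hU : reduction p (V₁ ⊓ V₂) = reduction p V₁ ⊓ reduction p V₂) :
    ∃ R : Submodule K (n → K), reduction p R = S ∧
      finrank p.residueField ↥(reduction p V₁ ⊓ S) ≤ finrank K ↥(V₁ ⊓ R) ∧
      finrank p.residueField ↥(reduction p V₂ ⊓ S) ≤ finrank K ↥(V₂ ⊓ R) := by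
  -- the three subspaces of `S`
  have hW : (reduction p V₁ ⊓ S) ⊓ (reduction p V₂ ⊓ S) = reduction p (V₁ ⊓ V₂) ⊓ S := by
    rw [hU, inf_inf_inf_comm, inf_idem]
  -- a basis `C̄` of `Ū ∩ S`, completed inside `V̄₁ ∩ S` and inside `V̄₂ ∩ S`
  obtain ⟨a, cb, hcb, cli, cspan⟩ := exists_basis_fin (reduction p (V₁ ⊓ V₂) ⊓ S)
  have hcb₁ : ∀ l, cb l ∈ reduction p V₁ ⊓ S := fun l ↦
    ⟨reduction_mono p inf_le_left (hcb l).1, (hcb l).2⟩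
  have hcb₂ : ∀ l, cb l ∈ reduction p V₂ ⊓ S := fun l ↦
    ⟨reduction_mono p inf_le_right (hcb l).1, (hcb l).2⟩
  obtain ⟨b₁, d₁, hd₁, hli₁, hspan₁⟩ :=
    exists_linearIndependent_extension (reduction p V₁ ⊓ S) hcb₁ cli
  obtain ⟨b₂, d₂, hd₂, hli₂, hspan₂⟩ :=
    exists_linearIndependent_extension (reduction p V₂ ⊓ S) hcb₂ cli
  have hA : AdaptedBases (reduction p V₁ ⊓ S) (reduction p V₂ ⊓ S) cb d₁ d₂ :=
    ⟨cli, cspan.trans hW.symm, hli₁, hspan₁, hli₂, hspan₂⟩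
  have hli3 := hA.li_uxy
  have hmemS : ∀ i, Sum.elim cb (Sum.elim d₁ d₂) i ∈ S := by
    rintro (l | i | i)
    · exact (hcb l).2
    · exact (hd₁ i).2
    · exact (hd₂ i).2
  -- completed to a basis of `S`
  obtain ⟨b, d, -, hliS, hspanS⟩ := exists_linearIndependent_extension S hmemS hli3
  -- lifts
  choose C hCmem hCred using fun l ↦ (mem_reduction_iff p).1 (hcb l).1
  choose D₁ hD₁mem hD₁red using fun i ↦ (mem_reduction_iff p).1 (hd₁ i).1
  choose D₂ hD₂mem hD₂red using fun i ↦ (mem_reduction_iff p).1 (hd₂ i).1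
  choose D hDred using fun j ↦ redVec_surjective p (d j)
  set G : (Fin a ⊕ (Fin b₁ ⊕ Fin b₂)) ⊕ Fin b → n → p.toValuationSubring :=
    Sum.elim (Sum.elim C (Sum.elim D₁ D₂)) D with hG
  have hGred : (fun i ↦ redVec p (G i)) = Sum.elim (Sum.elim cb (Sum.elim d₁ d₂)) d := by
    funext i
    rcases i with (l | i | i) | j
    · exact hCred l
    · exact hD₁red i
    · exact hD₂red i
    · exact hDred j
  set R := span K (Set.range fun i ↦ inclVec p (G i)) with hR
  refine ⟨R, ?_, ?_, ?_⟩
  · -- `R̄ = S`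
    have hle : S ≤ reduction p R := by
      rw [← hspanS, span_le]
      rintro _ ⟨i, rfl⟩
      rw [SetLike.mem_coe, show Sum.elim (Sum.elim cb (Sum.elim d₁ d₂)) d i = redVec p (G i) from
        (congr_fun hGred i).symm]
      exact redVec_mem_reduction p ((mem_integralPoints p).2 (subset_span ⟨i, rfl⟩))
    have hfin : finrank p.residueField ↥(reduction p R) ≤ finrank p.residueField S := by
      rw [finrank_reduction, ← hspanS, finrank_span_eq_card hliS]
      exact finrank_range_le_card _
    exact (Submodule.eq_of_le_of_finrank_le hle hfin).symm
  · -- `dim_K (V₁ ∩ R) ≥ dim_κ (V̄₁ ∩ S)`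
    have hsub : span K (Set.range fun i ↦ inclVec p (Sum.elim C D₁ i)) ≤ V₁ ⊓ R := by
      rw [span_le]
      rintro _ ⟨i, rfl⟩
      refine ⟨?_, ?_⟩
      · rcases i with l | i
        · exact ((mem_integralPoints p).1 (hCmem l)).1
        · exact (mem_integralPoints p).1 (hD₁mem i)
      · rcases i with l | i
        · exact subset_span ⟨Sum.inl (Sum.inl l), rfl⟩
        · exact subset_span ⟨Sum.inl (Sum.inr (Sum.inl i)), rfl⟩
    have hliK : LinearIndependent K fun i ↦ inclVec p (Sum.elim C D₁ i) := by
      apply linearIndependent_inclVec_of_redVec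
      have : (fun i ↦ redVec p (Sum.elim C D₁ i)) = Sum.elim cb d₁ := by
        funext i
        rcases i with l | i
        · exact hCred l
        · exact hD₁red i
      rw [this]; exact hli₁
    calc finrank p.residueField ↥(reduction p V₁ ⊓ S) = Fintype.card (Fin a ⊕ Fin b₁) := by
          rw [← hspan₁, finrank_span_eq_card hli₁]
      _ = finrank K ↥(span K (Set.range fun i ↦ inclVec p (Sum.elim C D₁ i))) :=
          (finrank_span_eq_card hliK).symm
      _ ≤ finrank K ↥(V₁ ⊓ R) := Submodule.finrank_mono hsub
  · -- `dim_K (V₂ ∩ R) ≥ dim_κ (V̄₂ ∩ S)`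
    have hsub : span K (Set.range fun i ↦ inclVec p (Sum.elim C D₂ i)) ≤ V₂ ⊓ R := by
      rw [span_le]
      rintro _ ⟨i, rfl⟩
      refine ⟨?_, ?_⟩
      · rcases i with l | i
        · exact ((mem_integralPoints p).1 (hCmem l)).2
        · exact (mem_integralPoints p).1 (hD₂mem i)
      · rcases i with l | i
        · exact subset_span ⟨Sum.inl (Sum.inl l), rfl⟩
        · exact subset_span ⟨Sum.inl (Sum.inr (Sum.inr i)), rfl⟩
    have hliK : LinearIndependent K fun i ↦ inclVec p (Sum.elim C D₂ i) := by
      apply linearIndependent_inclVec_of_redVec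
      have : (fun i ↦ redVec p (Sum.elim C D₂ i)) = Sum.elim cb d₂ := by
        funext i
        rcases i with l | i
        · exact hCred l
        · exact hD₂red i
      rw [this]; exact hli₂
    calc finrank p.residueField ↥(reduction p V₂ ⊓ S) = Fintype.card (Fin a ⊕ Fin b₂) := by
          rw [← hspan₂, finrank_span_eq_card hli₂]
      _ = finrank K ↥(span K (Set.range fun i ↦ inclVec p (Sum.elim C D₂ i))) :=
          (finrank_span_eq_card hliK).symm
      _ ≤ finrank K ↥(V₂ ⊓ R) := Submodule.finrank_mono hsub

end Lifting

/-! ### Tools for the proof of Théorème 4.1 (steps 4, 6, 8) -/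

section Thm41Tools

variable (p : PlaceOver k K)

omit [Fintype n] in
/-- `h(x) ≤ h₁(x)`: the projective height is at most the affine height. [cite: RoyWaldschmidt1997ENS, §4, p. 772] -/
theorem projHeight_le_affHeight [IsAlgFunctionField k K] {ι : Type*} [Fintype ι] (x : ι → K) :
    projHeight k x ≤ affHeight k x := by
  obtain ⟨T, hT, -⟩ := exists_finset_places (k := k) {x} ∅
  rw [projHeight_eq_sum x T (hT x (by simp)), affHeight_eq_sum x T (hT x (by simp))]
  refine Finset.sum_le_sum fun q _ ↦ ?_
  rw [neg_mul_eq_neg_mul]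
  exact mul_le_mul_of_nonneg_right (le_max_right _ _) (Nat.cast_nonneg _)

/-- **`h₁(x₁ ∧ ⋯ ∧ x_m) ≤ ∑ᵢ h₁(xᵢ)`** (each maximal minor is a determinant whose rows are
sub-tuples of the `xᵢ`; step 4 of the proof of Théorème 4.1 for a single minor).
[cite: RoyWaldschmidt1997ENS, §4, p. 777] -/
theorem affHeight_minors_le [IsAlgFunctionField k K] {r : Type*} [Fintype r] [DecidableEq r]
    (x : r → n → K) : affHeight k (minors x) ≤ ∑ i, affHeight k (x i) := by
  refine affHeight_le_sum_of_forall Finset.univ fun q ↦ ?_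
  by_cases h0 : minors x = 0
  · rw [h0, ordVec_zero, min_self]
    exact Finset.sum_nonpos fun i _ ↦ min_le_left _ _
  obtain ⟨f, hf, hqf⟩ := exists_ordVec_eq q h0
  rw [hqf]
  -- transpose the minor so that its columns are the sub-tuples `xᵢ ∘ f`
  set N : Matrix r r K := Matrix.of fun j i ↦ x i (f j) with hN
  have hdet : minors x f = N.det := by
    rw [minors_apply, ← Matrix.det_transpose]; rfl
  have h1 := sum_min_ordVec_col_le_min_ord_det q N
  rw [← hdet] at h1
  refine le_trans (Finset.sum_le_sum fun i _ ↦ ?_) h1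
  show min 0 (ordVec q (x i)) ≤ min 0 (ordVec q fun j ↦ x i (f j))
  by_cases hi : (fun j ↦ x i (f j)) = 0
  · rw [hi, ordVec_zero, min_self]; exact min_le_left _ _
  · exact min_le_min le_rfl (ordVec_le_ordVec_comp q (x i) f hi)

/-- **`h(V) ≤ ∑ᵢ h₁(xᵢ)` for a basis `x₁, …, x_m` of `V`** (steps 6 and 8 of the proof of
Théorème 4.1: "`h(W) ≤ ℓ₀ log B₂`", "`h(V₂) ≤ 2d₀ log B₁`").
[cite: RoyWaldschmidt1997ENS, §4, pp. 778–779] -/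
theorem subspaceHeight_le_sum_affHeight [IsAlgFunctionField k K] {r : Type*} [Fintype r]
    [DecidableEq r] {V : Submodule K (n → K)} {x : r → n → K} (hli : LinearIndependent K x)
    (hspan : span K (Set.range x) = V) : subspaceHeight k V ≤ ∑ i, affHeight k (x i) := by
  rw [subspaceHeight_eq hli hspan]
  exact (projHeight_le_affHeight (minors x)).trans (affHeight_minors_le x)

/-- **Steps 4 and 8 of the proof of Théorème 4.1**: a family of integral vectors, linearly
independent over `K`, with `h₁(x₁ ∧ ⋯ ∧ x_m) < D`, is a `𝔭`-regular basis of its span ("puisque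
cette base est contenue dans `𝒪ⁿ` et vérifie `h₁(x₁ ∧ ⋯ ∧ x_m) < 2d₀ log B₁`, les lemmes 4.2 et 4.3
montrent qu'il s'agit d'une base régulière"). [cite: RoyWaldschmidt1997ENS, §4, pp. 777–779] -/
theorem isRegularBasis_of_affHeight_minors_lt [IsAlgFunctionField k K] {r : Type*} [Fintype r]
    [DecidableEq r] {x : r → n → p.toValuationSubring}
    (hli : LinearIndependent K fun i ↦ inclVec p (x i))
    (h : affHeight k (minors fun i ↦ inclVec p (x i)) < p.degree) :
    IsRegularBasis p (span K (Set.range fun i ↦ inclVec p (x i))) x := by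
  have hvec : (fun f : r → n ↦ ((minors x f : p.toValuationSubring) : K)) =
      minors fun i ↦ inclVec p (x i) :=
    funext fun f ↦ (minors_inclVec_eq p x f).symm
  have hne : (minors fun i ↦ inclVec p (x i)) ≠ 0 := by
    obtain ⟨f, hf⟩ := exists_minors_ne_zero hli
    exact fun h0 ↦ hf (congr_fun h0 f)
  refine isRegularBasis_of_ordVec_minors_eq_zero (fun i ↦ (mem_integralPoints p).2
    (subset_span ⟨i, rfl⟩)) (finrank_span_eq_card hli).symm (by rw [hvec]; exact hne) ?_
  rw [hvec]
  obtain ⟨f, hf, hqf⟩ := exists_ordVec_eq p hne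
  rw [hqf]
  refine ord_eq_zero_of_affHeight_lt_degree p hf (lt_of_le_of_lt ?_ h)
  exact affHeight_apply_le (minors fun i ↦ inclVec p (x i)) f

/-- The same with the hypothesis `∑ᵢ h₁(xᵢ) < D` (step 4: "`h₁(Δ) ≤ ∑ⱼ h₁(wⱼ) ≤ ℓ₀ log B₂ < D`
donc `ord_𝔭(Δ) = 0` … l'affirmation découle du lemme 4.3"). [cite: RoyWaldschmidt1997ENS, §4, pp. 777–778] -/
theorem isRegularBasis_of_sum_affHeight_lt [IsAlgFunctionField k K] {r : Type*} [Fintype r]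
    [DecidableEq r] {x : r → n → p.toValuationSubring}
    (hli : LinearIndependent K fun i ↦ inclVec p (x i))
    (h : ∑ i, affHeight k (inclVec p (x i)) < p.degree) :
    IsRegularBasis p (span K (Set.range fun i ↦ inclVec p (x i))) x :=
  isRegularBasis_of_affHeight_minors_lt p hli ((affHeight_minors_le _).trans_lt h)

end Thm41Tools

end RoyWaldschmidt1997

end Literature.NumberTheory.Transcendental
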